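import Mathlib.Analysis.InnerProductSpace.Basic
import Mathlib.Analysis.InnerProductSpace.Projection.Basic
import HarnessLib

/-!
# The axis Christoffel form paired with an ellipsoid gradient: `|dF(Γ(X, X))| ≤ 2K‖X‖²‖∇F‖`

Topic `Geometry/Riemannian` (an inner-product inequality). On the axis of the tube around
Weinstein's arc (Weinstein 1968, proof of the main theorem, step (2)) the Christoffel form of the
tube metric, for a relatively parallel orthonormal frame, is
`Γ(X, X) = X₁² κ - 2 X₁ ⟪κ, X'⟫ ε₀` (`X₁ = ⟪ε₀, X⟫`, `X' = X - X₁ ε₀`, `κ ⊥ ε₀` the curvature vector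
of the arc in the frame, `‖κ‖ ≤ K`), and the gradient of the ellipsoid function
`F(x) = ⟪ε₀, x⟫²/L² + ‖x - ⟪ε₀, x⟫ε₀‖²/r²` is of the form `α ε₀ + β p` with `p ⊥ ε₀`. The pairing
obeys

* `abs_inner_axisChristoffel_le` — **`|⟪α ε₀ + β p, Γ(X, X)⟫| ≤ 2 K ‖X‖² ‖α ε₀ + β p‖`**,

uniformly in `α, β` (i.e. in `L, r` and the point): the two surviving terms
`β X₁² ⟪p, κ⟫ - 2 α X₁ ⟪κ, X'⟫` are bounded by `‖α ε₀ + β p‖ · K (X₁² + 2|X₁|‖X'‖)` since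
`|α|, |β|‖p‖ ≤ ‖α ε₀ + β p‖` (orthogonality), and `X₁² + 2|X₁|‖X'‖ ≤ 2‖X‖²`. This is the algebraic
reason why the second fundamental form of the thin ellipsoid is `≥ -λ` with `λ` controlled by the
geodesic curvature of the arc alone, whatever the eccentricity `L/r`.

## References

* A. Weinstein, *The cut locus and conjugate locus of a Riemannian manifold*, Ann. of Math. (2)
  87 (1968), 29–41, proof of the main theorem, step (2). [cite: Weinstein1968]

Tags: [InnerProductInequality] [Weinstein1968]
-/

noncomputable section

open scoped RealInnerProductSpace

namespace Literature.Geometry.Riemannian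

variable {V : Type*} [NormedAddCommGroup V] [InnerProductSpace ℝ V]

/-- `|α| ≤ ‖α ε₀ + β p‖` and `|β| ‖p‖ ≤ ‖α ε₀ + β p‖` for a unit `ε₀ ⊥ p` (Pythagoras). [folklore] -/
theorem abs_le_norm_add_of_inner_eq_zero {ε₀ p : V} (hε₀ : ‖ε₀‖ = 1) (hp : ⟪ε₀, p⟫ = 0)
    (α β : ℝ) :
    |α| ≤ ‖α • ε₀ + β • p‖ ∧ |β| * ‖p‖ ≤ ‖α • ε₀ + β • p‖ := by
  have horth : ⟪α • ε₀, β • p⟫ = 0 := by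
    rw [inner_smul_left, inner_smul_right, hp, mul_zero, mul_zero]
  have hsq : ‖α • ε₀ + β • p‖ * ‖α • ε₀ + β • p‖ =
      ‖α • ε₀‖ * ‖α • ε₀‖ + ‖β • p‖ * ‖β • p‖ :=
    norm_add_sq_eq_norm_sq_add_norm_sq_of_inner_eq_zero _ _ horth
  have h1 : ‖α • ε₀‖ = |α| := by rw [norm_smul, Real.norm_eq_abs, hε₀, mul_one]
  have h2 : ‖β • p‖ = |β| * ‖p‖ := by rw [norm_smul, Real.norm_eq_abs]
  rw [h1, h2] at hsq
  have hn : 0 ≤ ‖α • ε₀ + β • p‖ := norm_nonneg _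
  have hb : 0 ≤ |β| * ‖p‖ := mul_nonneg (abs_nonneg _) (norm_nonneg _)
  constructor
  · nlinarith [abs_nonneg α]
  · nlinarith [abs_nonneg α]

/-- **`|⟪α ε₀ + β p, Γ(X, X)⟫| ≤ 2 K ‖X‖² ‖α ε₀ + β p‖`** for the axis Christoffel form
`Γ(X, X) = ⟪ε₀, X⟫² κ - 2 ⟪ε₀, X⟫ ⟪κ, X - ⟪ε₀, X⟫ ε₀⟫ ε₀` of a tube with relatively parallel
orthonormal frame (`ε₀` unit, `κ, p ⊥ ε₀`, `‖κ‖ ≤ K`). [cite: Weinstein1968, proof of the main theorem, step (2)] -/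
theorem abs_inner_axisChristoffel_le {ε₀ p κ : V} (hε₀ : ‖ε₀‖ = 1) (hp : ⟪ε₀, p⟫ = 0)
    (hκ : ⟪ε₀, κ⟫ = 0) {K : ℝ} (hK : ‖κ‖ ≤ K) (α β : ℝ) (X : V) :
    |⟪α • ε₀ + β • p,
        ⟪ε₀, X⟫ ^ 2 • κ - (2 * ⟪ε₀, X⟫ * ⟪κ, X - ⟪ε₀, X⟫ • ε₀⟫) • ε₀⟫| ≤
      2 * K * ‖X‖ ^ 2 * ‖α • ε₀ + β • p‖ := by
  set X₁ : ℝ := ⟪ε₀, X⟫ with hX₁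
  set X' : V := X - X₁ • ε₀ with hX'
  have hK0 : 0 ≤ K := le_trans (norm_nonneg _) hK
  have hee : ⟪ε₀, ε₀⟫ = 1 := by rw [real_inner_self_eq_norm_sq, hε₀, one_pow]
  -- the pairing has two surviving terms
  have hpair : ⟪α • ε₀ + β • p, X₁ ^ 2 • κ - (2 * X₁ * ⟪κ, X'⟫) • ε₀⟫ =
      β * X₁ ^ 2 * ⟪p, κ⟫ - α * (2 * X₁ * ⟪κ, X'⟫) := by
    have hpε : ⟪p, ε₀⟫ = 0 := by rw [real_inner_comm]; exact hp
    simp only [inner_add_left, inner_sub_right, inner_smul_left, inner_smul_right, hκ, hee, hpε,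
      RCLike.conj_to_real]
    ring
  -- `X = X₁ ε₀ + X'` orthogonally: `‖X‖² = X₁² + ‖X'‖²`
  have hX'perp : ⟪ε₀, X'⟫ = 0 := by
    rw [hX', inner_sub_right, inner_smul_right, hee, mul_one, sub_self]
  have hXdec : X = X₁ • ε₀ + X' := by rw [hX']; abel
  have hXsq : ‖X‖ ^ 2 = X₁ ^ 2 + ‖X'‖ ^ 2 := by
    have horth : ⟪X₁ • ε₀, X'⟫ = 0 := by rw [inner_smul_left, hX'perp, mul_zero]
    have h := norm_add_sq_eq_norm_sq_add_norm_sq_of_inner_eq_zero (X₁ • ε₀) X' horth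
    rw [← hXdec] at h
    have h1 : ‖X₁ • ε₀‖ = |X₁| := by rw [norm_smul, Real.norm_eq_abs, hε₀, mul_one]
    rw [h1] at h
    nlinarith [sq_abs X₁]
  -- the bounds on the two terms
  obtain ⟨hα, hβ⟩ := abs_le_norm_add_of_inner_eq_zero hε₀ hp α β
  set N : ℝ := ‖α • ε₀ + β • p‖ with hN
  have hN0 : 0 ≤ N := norm_nonneg _
  have ht1 : |β * X₁ ^ 2 * ⟪p, κ⟫| ≤ N * (X₁ ^ 2 * K) := by
    have h1 : |⟪p, κ⟫| ≤ ‖p‖ * ‖κ‖ := abs_real_inner_le_norm p κ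
    rw [abs_mul, abs_mul, abs_of_nonneg (sq_nonneg X₁)]
    calc |β| * X₁ ^ 2 * |⟪p, κ⟫| ≤ |β| * X₁ ^ 2 * (‖p‖ * K) := by
          apply mul_le_mul_of_nonneg_left (h1.trans (mul_le_mul_of_nonneg_left hK (norm_nonneg _)))
          exact mul_nonneg (abs_nonneg _) (sq_nonneg _)
      _ = (|β| * ‖p‖) * (X₁ ^ 2 * K) := by ring
      _ ≤ N * (X₁ ^ 2 * K) := mul_le_mul_of_nonneg_right hβ (mul_nonneg (sq_nonneg _) hK0)
  have ht2 : |α * (2 * X₁ * ⟪κ, X'⟫)| ≤ N * (2 * |X₁| * ‖X'‖ * K) := by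
    have h1 : |⟪κ, X'⟫| ≤ ‖κ‖ * ‖X'‖ := abs_real_inner_le_norm κ X'
    rw [abs_mul, abs_mul, abs_mul, abs_two]
    calc |α| * (2 * |X₁| * |⟪κ, X'⟫|) ≤ |α| * (2 * |X₁| * (K * ‖X'‖)) := by
          apply mul_le_mul_of_nonneg_left _ (abs_nonneg _)
          apply mul_le_mul_of_nonneg_left (h1.trans (mul_le_mul_of_nonneg_right hK (norm_nonneg _)))
          positivity
      _ = |α| * (2 * |X₁| * ‖X'‖ * K) := by ring
      _ ≤ N * (2 * |X₁| * ‖X'‖ * K) := by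
          apply mul_le_mul_of_nonneg_right hα
          positivity
  -- assemble
  rw [hpair]
  have h2X : X₁ ^ 2 + 2 * |X₁| * ‖X'‖ ≤ 2 * ‖X‖ ^ 2 := by
    rw [hXsq]
    nlinarith [sq_nonneg (|X₁| - ‖X'‖), sq_abs X₁, norm_nonneg X', abs_nonneg X₁]
  calc |β * X₁ ^ 2 * ⟪p, κ⟫ - α * (2 * X₁ * ⟪κ, X'⟫)|
      ≤ |β * X₁ ^ 2 * ⟪p, κ⟫| + |α * (2 * X₁ * ⟪κ, X'⟫)| := abs_sub _ _
    _ ≤ N * (X₁ ^ 2 * K) + N * (2 * |X₁| * ‖X'‖ * K) := add_le_add ht1 ht2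
    _ = N * K * (X₁ ^ 2 + 2 * |X₁| * ‖X'‖) := by ring
    _ ≤ N * K * (2 * ‖X‖ ^ 2) := by
        apply mul_le_mul_of_nonneg_left h2X (mul_nonneg hN0 hK0)
    _ = 2 * K * ‖X‖ ^ 2 * N := by ring

end Literature.Geometry.Riemannian

end
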